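import Summits.Ventures.HSemireg.UntwistCocycleTwistAtiyah
import Literature.AlgebraicGeometry.Modules.CechThetaTrace
import HarnessLib

/-!
# Venture HSemireg — route R1.0, untwisted reading: the trace with coefficients of a class multiplied by a
# SCALAR Čech class `[e ↦ e ⊗ ω]`: `Tr_G(y · [e ↦ e ⊗ ω]) = Tr(y) · [r ↦ r ω]` (gs-g4; sequel of
# `UntwistCocycleTwistAtiyah.lean`)

HONEST FRAMING. Module-level homological algebra on the tree's REAL carriers (Mathlib's `Abelian.Ext` in
`X.Modules`, the traces `HodgeTheory.traceExt` / `traceExtCoeff`, the Čech classes `Modules.Cech.classOf` and the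
exchange–evaluation chain maps of `Modules/CechSheafHomExchange.lean`). Nothing about any variety; no gerbe;
nothing here says HC, HC_CM or HC_AV is proved.

WHAT IS PROVED. For a finite locally free `F` on an `S`-scheme `X`, an open cover `𝓤 = (U_a)`, and a Čech
`1`-cochain of `1`-forms (sections `ω_{ab} ∈ Γ(G, U_{ab})` of any module `G`) whose scalar cochain
`s_{ab} = (r ↦ r ω_{ab})` and tensor cochain `ν_{ab} = (e ↦ e ⊗ ω_{ab})` (`tensorWith`, previous file) are cocycles:

* `sheafHomMap_familyHom_exchange_contract` — the cochain identity
  `𝓗om(F, ν♯) ≫ κ_{c_G} = tr ≫ s♯ : 𝓔nd(F) → Č¹(𝓤, G)` (in a frame: `c_G(Φ ≫ (e ↦ e ⊗ ω)) = Σ_i b_i^*(Φ b_i) ω =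
  tr(Φ) ω`);
* `mapExactFunctor_classOf_tensorWith_comp_contract` — **`𝓗om(F, [ν]) · [c_G] = [tr] · [s]`** in
  `Ext¹(𝓔nd(F), G)` (Čech `θ` commutes with the exact functor `𝓗om(F, –)`, `ExactAugmentation.theta_mapFunctor`, and
  is natural along the exchange chain map `κ_{c_G}`, `theta_comp_map`; then the cochain identity and `theta_comp_left`);
* `traceExtCoeff_comp_classOf_tensorWith` — **`Tr_G(y · [ν]) = Tr(y) · [s]` in `Extⁿ⁺¹(𝒪_X, G)` for every
  `y ∈ Extⁿ(F, F)`** (`Tr_G = u ≫ 𝓗om(F, –) ≫ c_G`, `Tr = u ≫ 𝓗om(F, –) ≫ tr`): the "scalar classes are central and the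
  trace is linear over them" identity `Tr(y · (1_F ⊗ κ)) = Tr(y) ∪ κ` of Buchweitz–Flenner's algebra, for the scalar
  classes the tree can name (Čech classes of `1`-forms), ARBITRARY `y` (not necessarily a Čech class);
* `dFamily_twistDlogFamily` — the scalar cochain `ω_{xy} = -g_{xy} d g_{yx}` of a cocycle twist IS a cocycle
  (`dlog(g_{xy} g_{yz}) = dlog g_{xy} + dlog g_{yz}`: Atiyah 1957 Prop. 12), and the specialisation
  `traceExtCoeff_twist_comp_classOf_twistScalarFamily`: `Tr^{E⟨c⟩}_{Ω¹}(y · [ν]) = Tr^{E⟨c⟩}(y) · [dlog g]`.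

Which Ext groups: `Extⁿ(F, F)`, `Extⁿ⁺¹(F, F ⊗ G)`, `Extⁿ⁺¹(𝒪_X, G)`; which class: `c₁(M) = [dlog g] ∈ Ext¹(𝒪_X, Ω¹)` as a
Čech class; which twist: `- ⊗ M_B`, `M_B = lineBundle c`.

## References

* R.-O. Buchweitz, H. Flenner, *A semiregularity map for modules and applications to deformations*, Compositio
  Math. 137 (2003), §4 (trace maps, the algebra `A`). [BuchweitzFlenner2003]
* M. F. Atiyah, *Complex analytic connections in fibre bundles*, Trans. AMS 85 (1957), Prop. 12. [Atiyah1957]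
* R. Hartshorne, *Algebraic Geometry* (1977), III.4 (Čech cohomology). [Hartshorne1977]
-/

noncomputable section

open CategoryTheory CategoryTheory.Abelian AlgebraicGeometry Opposite TopologicalSpace Limits

namespace Summit.Ventures.HSemireg

namespace CocycleTwist

open Literature.AlgebraicGeometry.Modules Literature.AlgebraicGeometry.Motives
  Literature.AlgebraicGeometry.HodgeTheory Literature.AlgebraicGeometry.Modules.Cech Literature.Algebra.Homology

universe u

variable {S : Type u} [CommRing S] {X : Over (Spec (CommRingCat.of S))}

/-! ### Locality for morphisms out of an internal Hom along the frames of a finite locally free module -/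

/-- Two morphisms `𝓗om(A, M) → G` agree if they agree on sections over every open carrying a finite frame of the
finite locally free module `E` (such opens cover `X`; th-4's `hom_ext_of_frames_le` without the cocycle cover).
[folklore] -/
theorem hom_ext_of_frames {E : X.left.Modules} (hE : IsFiniteLocallyFree E) {A M G : X.left.Modules}
    {α β : sheafHom A M ⟶ G}
    (h : ∀ ⦃W : X.left.Opens⦄ ⦃I : Type u⦄ [Fintype I] (_f : SheafOfModules.free I ≅ E.over W)
      (ψ : A.over W ⟶ M.over W), α.app W ψ = β.app W ψ) : α = β := by
  refine Scheme.Modules.hom_ext _ _ fun U => AddCommGrpCat.ext fun (φ : A.over U ⟶ M.over U) => ?_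
  refine TopCat.Sheaf.eq_of_locally_eq' ((SheafOfModules.toSheaf _).obj G)
    (fun x : U => piece hE U x) U (fun x => homOfLE inf_le_left)
    (fun y hy => Opens.mem_iSup.2 ⟨⟨y, hy⟩, hy, mem_trivNbhd hE y⟩) _ _ fun x => ?_
  change G.presheaf.map (homOfLE _).op (α.app U φ) = G.presheaf.map (homOfLE _).op (β.app U φ)
  rw [← Scheme.Modules.Hom.app_map_apply, ← Scheme.Modules.Hom.app_map_apply]
  exact h (pieceFrame hE x) _

/-! ### Components of a composite `Φ ≫ ψ : E'|_W → E|_W → Čⁿ(𝓤, M)|_W` -/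

section Component

variable {ι : Type u} {U : ι → X.left.Opens} {n : ℕ} {E' E M : X.left.Modules} {W : X.left.Opens}

/-- `(Φ ≫ ψ)_α = Φ| ≫ ψ_α`. [folklore] -/
theorem componentOver_comp (Φ : E'.over W ⟶ E.over W) (ψ : E.over W ⟶ (obj U n M).over W) (α : Fin (n + 1) → ι) :
    componentOver (Φ ≫ ψ) α = restrictHom (homOfLE inf_le_left) Φ ≫ componentOver ψ α :=
  hom_ext_of_appLE fun _ _ _ => rfl

end Component

/-! ### The cochain identity `𝓗om(F, ν♯) ≫ κ_{c_G} = tr ≫ s♯` -/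

section Cochain

variable {ι : Type u} {U : ι → X.left.Opens} {F G : X.left.Modules} (hF : IsFiniteLocallyFree F)
  (ω : ∀ β : Fin 2 → ι, Γ(G, face U β))

/-- The scalar cochain `s_{ab} = (r ↦ r · ω_{ab}) : 𝒪|_{U_{ab}} → G|_{U_{ab}}`. [folklore] -/
def scalarFamily : LocalFamily U 1 (unitModule X.left) G := fun β => smulSection (ω β)

/-- The tensor cochain `ν_{ab} = (e ↦ e ⊗ ω_{ab}) : F|_{U_{ab}} → (F ⊗ G)|_{U_{ab}}`. [folklore] -/
def tensorFamily (F : X.left.Modules) : LocalFamily U 1 F (sheafHom (dual F) G) := fun β => tensorWith F G (ω β)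

/-- **In a frame: `c_G(Φ ≫ (e ↦ e ⊗ ω)) = tr(Φ) · ω`** (`Σ_i (Φ b_i ⊗ ω)(b_i^*) = (Σ_i b_i^*(Φ b_i)) ω`).
[cite: BuchweitzFlenner2003, §4 (trace map)] -/
theorem contract_app_comp_tensorWith {W : X.left.Opens} {I : Type u} [Fintype I] (f : SheafOfModules.free I ≅ F.over W)
    (Φ : F.over W ⟶ F.over W) (η : Γ(G, W)) :
    (contract hF G).app W (Φ ≫ tensorWith F G η) = appLE (smulSection η) (𝟙 W) ((trace hF).app W Φ) := by
  rw [contract_app_eq_frameContract hF G f, frameContract, trace_app_eq_sum hF f,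
    show appLE (smulSection η) (𝟙 W) (∑ i, appLE (dualBasis f i) (𝟙 W) (appLE Φ (𝟙 W) (basisSection f i))) =
        ∑ i, appLE (smulSection η) (𝟙 W) (appLE (dualBasis f i) (𝟙 W) (appLE Φ (𝟙 W) (basisSection f i))) from
      map_sum (AddMonoidHom.mk' (fun r => appLE (smulSection η) (𝟙 W) r) (appLE_add_right (smulSection η) (𝟙 W))) _ _]
  refine Finset.sum_congr rfl fun i _ => ?_
  rw [appLE_smulSection, appLE_comp, appLE_tensorWith, tensorForm_def, op_id, G.presheaf.map_id]
  change appLE (evalAt (M := unitModule X.left) (appLE Φ (𝟙 W) (basisSection f i)) ≫ smulSection η) (𝟙 W)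
    (dualBasis f i : Γ(dual F, W)) = _
  rw [appLE_comp, appLE_evalAt, appLE_smulSection, op_id, F.presheaf.map_id, G.presheaf.map_id]
  rfl

/-- **The cochain identity `𝓗om(F, ν♯) ≫ κ_{c_G} = tr ≫ s♯ : 𝓔nd(F) → Č¹(𝓤, G)`**: the `ab`-component of
`c_G(Φ ≫ ν)` is `tr(Φ) ω_{ab}`. [cite: BuchweitzFlenner2003, §4 (trace map)] -/
theorem sheafHomMap_familyHom_exchange_contract :
    sheafHomMap F (familyHom (tensorFamily ω F)) ≫ exchange 1 (contract hF G) =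
      trace hF ≫ familyHom (scalarFamily ω) := by
  refine hom_ext_of_frames hF fun W I _ f (Φ : F.over W ⟶ F.over W) => ?_
  rw [Scheme.Modules.Hom.comp_app, CategoryTheory.comp_apply, Scheme.Modules.Hom.comp_app,
    CategoryTheory.comp_apply, sheafHomMap_app_apply]
  refine funext fun α => ?_
  rw [exchange_app_apply, componentOver_comp, componentOver_over_map_familyHom, familyHom_app_apply, tensorFamily,
    scalarFamily]
  have hr : restrictHom (homOfLE (inf_le_right : W ⊓ face U α ≤ face U α)) (tensorWith F G (ω α)) =
      tensorWith F G (G.presheaf.map (homOfLE (inf_le_right : W ⊓ face U α ≤ face U α)).op (ω α)) :=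
    hom_ext_of_appLE fun W' k e => by rw [appLE_restrictHom, appLE_tensorWith, appLE_tensorWith, presheaf_map_map]
  rw [hr, contract_app_comp_tensorWith hF
      (SheafOfModules.restrictTrivialisation (R := X.left.ringCatSheaf) (homOfLE inf_le_left) f),
    Cech.app_restrictHom (trace hF) (inf_le_left : W ⊓ face U α ≤ W) Φ, appLE_smulSection, appLE_smulSection,
    op_id, G.presheaf.map_id]
  rfl

end Cochain

/-! ### `𝓗om(F, [ν]) · [c_G] = [tr] · [s]` and `Tr_G(y · [ν]) = Tr(y) · [s]` -/

section Trace

variable {ι : Type u} {U : ι → X.left.Opens} (hU : iSup U = ⊤) {F G : X.left.Modules} (hF : IsFiniteLocallyFree F)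
  (ω : ∀ β : Fin 2 → ι, Γ(G, face U β)) (hs : dFamily (scalarFamily ω) = 0) (hν : dFamily (tensorFamily ω F) = 0)
  [HasExt.{u + 1} X.left.Modules]

/-- **`𝓗om(F, [ν]) · [c_G] = [tr] · [s]` in `Ext¹(𝓔nd(F), G)`** for the tensor cochain `ν = (e ↦ e ⊗ ω)` and the
scalar cochain `s = (r ↦ r ω)` of a cochain of forms `ω` (both cocycles): `θ` commutes with `𝓗om(F, –)`
(`theta_mapFunctor`), is natural along `κ_{c_G}` (`theta_comp_map`, `exchange_augment`), and the cochain identity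
`sheafHomMap_familyHom_exchange_contract`. [cite: BuchweitzFlenner2003, §4 (trace map)] -/
theorem mapExactFunctor_classOf_tensorFamily_comp_contract :
    haveI := preservesFiniteColimits_sheafHomFunctor F hF
    ((classOf (exactAugmentation U (sheafHom (dual F) G) hU) (tensorFamily ω F) hν).mapExactFunctor
        (sheafHomFunctor F)).comp (Ext.mk₀ (contract hF G)) (add_zero 1) =
      (Ext.mk₀ (trace hF)).comp (classOf (exactAugmentation U G hU) (scalarFamily ω) hs) (zero_add 1) := by
  haveI := preservesFiniteColimits_sheafHomFunctor F hF
  have hωK : familyHom (tensorFamily ω F) ≫ (complex U (sheafHom (dual F) G)).d 1 (1 + 1) = 0 :=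
    familyHom_comp_d_eq_zero _ hν
  have hΦ : (sheafHomFunctor F).map (familyHom (tensorFamily ω F)) ≫
      (ExactAugmentation.mapK (sheafHomFunctor F) (complex U (sheafHom (dual F) G))).d 1 (1 + 1) = 0 :=
    ExactAugmentation.map_d_eq_zero (K := complex U (sheafHom (dual F) G)) (sheafHomFunctor F) _ hωK
  have hκ : ((sheafHomFunctor F).map (familyHom (tensorFamily ω F)) ≫
      (exchangeChainMap U (sheafHom (dual F) G) (contract hF G)).f 1) ≫ (complex U G).d 1 (1 + 1) = 0 :=
    ExactAugmentation.comp_f_d_eq_zero (exchangeChainMap U _ (contract hF G)) _ hΦ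
  have hμ : ((exactAugmentation U (sheafHom (dual F) G) hU).mapFunctor (sheafHomFunctor F)).ε ≫
      (exchangeChainMap U (sheafHom (dual F) G) (contract hF G)).f 0 = contract hF G ≫ (exactAugmentation U G hU).ε :=
    exchange_augment (contract hF G)
  have hts : (trace hF ≫ familyHom (scalarFamily ω)) ≫ (complex U G).d 1 (1 + 1) = 0 := by
    rw [Category.assoc, familyHom_comp_d_eq_zero _ hs, Limits.comp_zero]
  have e1 : (classOf (exactAugmentation U (sheafHom (dual F) G) hU) (tensorFamily ω F) hν).mapExactFunctor
        (sheafHomFunctor F) =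
      ((exactAugmentation U (sheafHom (dual F) G) hU).mapFunctor (sheafHomFunctor F)).theta
        ((sheafHomFunctor F).map (familyHom (tensorFamily ω F))) hΦ :=
    (ExactAugmentation.theta_mapFunctor (sheafHomFunctor F) (exactAugmentation U _ hU) _ hωK hΦ).symm
  have e2 : (((exactAugmentation U (sheafHom (dual F) G) hU).mapFunctor (sheafHomFunctor F)).theta
        ((sheafHomFunctor F).map (familyHom (tensorFamily ω F))) hΦ).comp (Ext.mk₀ (contract hF G)) (add_zero 1) =
      (exactAugmentation U G hU).theta ((sheafHomFunctor F).map (familyHom (tensorFamily ω F)) ≫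
        (exchangeChainMap U (sheafHom (dual F) G) (contract hF G)).f 1) hκ :=
    (ExactAugmentation.theta_comp_map ((exactAugmentation U _ hU).mapFunctor (sheafHomFunctor F))
      (exactAugmentation U G hU) (exchangeChainMap U _ (contract hF G)) (contract hF G) hμ _ hΦ hκ).symm
  have e3 : (exactAugmentation U G hU).theta ((sheafHomFunctor F).map (familyHom (tensorFamily ω F)) ≫
        (exchangeChainMap U (sheafHom (dual F) G) (contract hF G)).f 1) hκ =
      (exactAugmentation U G hU).theta (trace hF ≫ familyHom (scalarFamily ω)) hts :=
    (exactAugmentation U G hU).theta_congr (by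
      rw [exchangeChainMap_f]; exact sheafHomMap_familyHom_exchange_contract hF ω) _ _
  rw [e1, e2, e3, classOf_def]
  exact (exactAugmentation U G hU).theta_comp_left (trace hF) (familyHom (scalarFamily ω))
    (familyHom_comp_d_eq_zero _ hs)

/-- **`Tr_G(y · [ν]) = Tr(y) · [s]` in `Extⁿ⁺¹(𝒪_X, G)`** for EVERY `y ∈ Extⁿ(F, F)` (`F` finite locally free), the
tensor cochain `ν = (e ↦ e ⊗ ω)` and the scalar cochain `s = (r ↦ r ω)` of a cochain of forms (both cocycles):
the trace with coefficients is linear over scalar Čech classes — Buchweitz–Flenner's `Tr(y · (1 ⊗ κ)) = Tr(y) ∪ κ`.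
[cite: BuchweitzFlenner2003, §4 (trace map)] -/
theorem traceExtCoeff_comp_classOf_tensorFamily {n : ℕ} (y : Ext.{u + 1} F F n) :
    traceExtCoeff hF G (n + 1)
        (y.comp (classOf (exactAugmentation U (sheafHom (dual F) G) hU) (tensorFamily ω F) hν) rfl) =
      (traceExt hF n y).comp (classOf (exactAugmentation U G hU) (scalarFamily ω) hs) rfl := by
  haveI := preservesFiniteColimits_sheafHomFunctor F hF
  rw [traceExtCoeff_apply, traceExt_apply, Ext.mapExactFunctor_comp,
    Ext.comp_assoc _ _ _ (rfl : n + 1 = n + 1) (add_zero 1) (show n + 1 + 0 = n + 1 by omega),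
    mapExactFunctor_classOf_tensorFamily_comp_contract hU hF ω hs hν]
  symm
  rw [Ext.comp_assoc _ _ _ (zero_add n) (rfl : n + 1 = n + 1) (show 0 + n + 1 = n + 1 by omega)]
  congr 1
  exact Ext.comp_assoc_of_second_deg_zero _ _ _ _

end Trace

/-! ### The scalar cochain of a cocycle twist is a cocycle; the trace of `y · [ν]` for `ν` of `At(E⟨c⟩)` -/

section Twist

variable (c : UnitCocycle X.left) {E : X.left.Modules} (hE : IsFiniteLocallyFree E)

/-- The cochain of `1`-forms `ω_{xy} = -g_{xy} d g_{yx}` on the cover `W_x` of `UntwistCocycleTwistAtiyah`. [folklore] -/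
def twistDlogForms (β : Fin 2 → X.left) : Γ(cotangentSheaf X, face (leibnizCover c hE) β) :=
  dlogForm c (β 0) (β 1) (face (leibnizCover c hE) β)
    ((face_le _ β 0).trans (leibnizCover_le c hE (β 0))) ((face_le _ β 1).trans (leibnizCover_le c hE (β 1)))

/-- The tensor cochain of `twistDlogForms` is `ν` of `atiyahClass_twist`. [folklore] -/
theorem tensorFamily_twistDlogForms : tensorFamily (twistDlogForms c hE) (twist c E) = twistScalarFamily c hE := rfl

/-- **`dlog` is a cocycle**: `ω_{yz} - ω_{xz} + ω_{xy} = 0` for `ω_{xy} = -g_{xy} d g_{yx}` (`g_{zx} = g_{zy} g_{yx}`,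
Leibniz rule for `d`, `g_{xy} g_{yx} = 1`). [cite: Atiyah1957, Prop. 12] -/
theorem dlogForm_cocycle (x y z : X.left) (V : X.left.Opens) (hx : V ≤ c.U x) (hy : V ≤ c.U y) (hz : V ≤ c.U z) :
    dlogForm c y z V hy hz - dlogForm c x z V hx hz + dlogForm c x y V hx hy = 0 := by
  simp only [dlogForm]
  have hzx : c.g z x V hz hx = c.g z y V hz hy * c.g y x V hy hx := (c.g_mul z y x V hz hy hx).symm
  have e1 : dSection X V (c.g z x V hz hx) =
      c.g z y V hz hy • dSection X V (c.g y x V hy hx) + c.g y x V hy hx • dSection X V (c.g z y V hz hy) := by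
    rw [hzx, dSection_mul]
  rw [e1, smul_add, smul_smul, smul_smul, ← c.g_mul x y z V hx hy hz, mul_assoc, c.g_mul y z y V hy hz hy, c.g_self,
    mul_one, mul_comm (c.g x y V hx hy) (c.g y z V hy hz), mul_assoc, c.g_mul_symm, mul_one]
  abel

/-- **The scalar `dlog` cochain is a cocycle.** [cite: Atiyah1957, Prop. 12] -/
theorem dFamily_scalarFamily_twistDlogForms : dFamily (scalarFamily (twistDlogForms c hE)) = 0 := by
  funext β
  refine hom_ext_of_appLE fun V k (r : Γ(X.left, V)) => ?_
  rw [dFamily, appLE_sum, Fin.sum_univ_three, Pi.zero_apply, appLE_zero]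
  simp only [Fin.val_zero, pow_zero, one_smul, Fin.val_one, pow_one, neg_one_zsmul, Fin.val_two, neg_one_sq,
    appLE_neg', appLE_restrictHom, scalarFamily, appLE_smulSection, twistDlogForms, map_dlogForm]
  have hV0 : V ≤ c.U (β 0) := (k.le.trans (face_le _ β 0)).trans (leibnizCover_le c hE (β 0))
  have hV1 : V ≤ c.U (β 1) := (k.le.trans (face_le _ β 1)).trans (leibnizCover_le c hE (β 1))
  have hV2 : V ≤ c.U (β 2) := (k.le.trans (face_le _ β 2)).trans (leibnizCover_le c hE (β 2))
  have key := congrArg (r • ·) (dlogForm_cocycle c (β 0) (β 1) (β 2) V hV0 hV1 hV2)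
  simp only [smul_add, smul_sub, smul_zero] at key
  change r • dlogForm c (β 1) (β 2) V _ _ + -(r • dlogForm c (β 0) (β 2) V _ _) + r • dlogForm c (β 0) (β 1) V _ _ = 0
  rw [← sub_eq_add_neg]
  exact key
where
  /-- Values of a negated local homomorphism. [folklore] -/
  appLE_neg' {M N : X.left.Modules} {W V : X.left.Opens} (φ : M.over W ⟶ N.over W) (k : V ⟶ W) (s : Γ(M, V)) :
      appLE (-φ) k s = -appLE φ k s := map_neg (appLEHom k s) φ

variable [HasExt.{u + 1} X.left.Modules]

/-- **`Tr^{E⟨c⟩}_{Ω¹}(y · [ν]) = Tr^{E⟨c⟩}(y) · [dlog g]`** for every `y ∈ Extⁿ(E⟨c⟩, E⟨c⟩)`, `ν` the scalar cochain of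
`atiyahClass_twist` and `[dlog g] ∈ Ext¹(𝒪_X, Ω¹)` the Čech class of the cocycle `r ↦ r ω_{xy}` (the first Chern class of
`M = lineBundle c` in Hodge cohomology, up to the sign convention of `ω`). [cite: BuchweitzFlenner2003, §4; Atiyah1957, Prop. 12] -/
theorem traceExtCoeff_twist_comp_classOf_twistScalarFamily {n : ℕ} (y : Ext.{u + 1} (twist c E) (twist c E) n) :
    traceExtCoeff (isFiniteLocallyFree_twist c hE) (cotangentSheaf X) (n + 1)
        (y.comp (classOf (exactAugmentation (leibnizCover c hE) _ (iSup_leibnizCover c hE)) (twistScalarFamily c hE)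
          (dFamily_twistScalarFamily c hE)) rfl) =
      (traceExt (isFiniteLocallyFree_twist c hE) n y).comp
        (classOf (exactAugmentation (leibnizCover c hE) _ (iSup_leibnizCover c hE)) (scalarFamily (twistDlogForms c hE))
          (dFamily_scalarFamily_twistDlogForms c hE)) rfl :=
  traceExtCoeff_comp_classOf_tensorFamily (iSup_leibnizCover c hE) (isFiniteLocallyFree_twist c hE) (twistDlogForms c hE)
    (dFamily_scalarFamily_twistDlogForms c hE) (dFamily_twistScalarFamily c hE) y

end Twist

end CocycleTwist

end Summit.Ventures.HSemireg

end
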